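import Mathlib
import Literature.Analysis.FluidPDE.SuitableWeak
import Literature.Analysis.FluidPDE.Seregin2023.TypeIIEulerZoom
import Literature.Analysis.FluidPDE.WholeSpaceIBP
import Summits.NavierStokesRegularity.NavierStokesRegularity.Theses.EulerZoomLiouville
import Summits.NavierStokesRegularity.NavierStokesRegularity.Theorems.EulerZoomLiouvillePowerGaugeEulerLiouvilleIrrotational
import Summits.NavierStokesRegularity.NavierStokesRegularity.Theorems.EulerZoomLiouvillePowerGaugeEulerLiouvilleAxisymNoSwirlScaling
import Summits.NavierStokesRegularity.NavierStokesRegularity.Theorems.EulerZoomLiouvillePowerGaugeEulerLiouvilleAxisymNoSwirlTransport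
import HarnessLib

/-!
# The AXISYMMETRIC SWIRL-FREE DISCRETELY SELF-SIMILAR stratum of the crux
# `EulerZoomLiouville.PowerGaugeEulerLiouville` (route №10, item stmt-NavierStokesRegularity-19832) —
# every `ρ > 0`

Helper file (theorems only; `--supports stmt-NavierStokesRegularity-19832`). Seat ns-typeII-p3 (cell
ns-regularity-ideate §B, D-0081). First landing on rungs C2 ∩ C3 and C1 ∩ C3 of the tenure planner's
in-window rung file `Cruxes/PowerGaugeEulerLiouville/Lines/rungC_window.lean` (C1 = exactly self-similar
members, C2 = discretely self-similar members, C3 = axisymmetric swirl-free members).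

THE STRATUM (`ae_eq_zero_of_gauge_of_axisymNoSwirl_dss`, binder form
`powerGaugeEulerLiouville_axisymNoSwirl_dss`). Let `(u, p, H, c)` be a member of Seregin's power-gauged
ancient Euler class with exponent `ρ > 0` (the three hypotheses of the crux VERBATIM) which moreover
(i) is a CLASSICAL Euler solution on the open slab `(−∞,0) × ℝ³`; (ii) has axisymmetric swirl-free
slices; (iii) is DISCRETELY SELF-SIMILAR for the class scaling with some factor `l > 1`,
`u(τ, y) = l^{1+ρ} u(l^{2+ρ} τ, l y)`; (iv) has, on every compact time interval `[s,t] ⊂ (−∞,0)`, bounded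
velocity and velocity gradient and square-integrable `η = ω_θ/r = angVortQuot (u τ)` with a uniform bound.
Then `u = 0` a.e. on the slab. The exactly self-similar members (rung C1 ∩ C3) are the case "every
`l > 0`" (`powerGaugeEulerLiouville_axisymNoSwirl_selfSimilar`, with `l = 2`).

THE LEVER is the Euler VORTICITY identity (not the local energy inequality): along a classical
swirl-free axisymmetric Euler flow `∂τη + u·∇η = 0`, so `‖η(τ)‖₂` is CONSERVED
(`integral_angVortQuot_sq_eq_of_classical`, prequel `…AxisymNoSwirlTransport.lean`); the class scaling
transforms `η(τ, y) = l^{3+ρ} η(l^{2+ρ}τ, l y)` hence `‖η(τ)‖₂² = l^{3+2ρ} ‖η(l^{2+ρ}τ)‖₂²` (prequel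
`…AxisymNoSwirlScaling.lean`); together `(l^{3+2ρ} − 1)‖η(τ)‖₂² = 0`, so `η ≡ 0`, `curl u ≡ 0`, and the
lead's irrotational stratum (`ae_eq_zero_of_symm_traceFree_of_growth`: harmonic Liouville under the
`A`-gauge growth `∫_{B(a)}|u|² ≤ c a^{1−2ρ}`) gives `u = 0`. In print the mechanism (an `L^p`-isometric
transport against a non-isometric self-similar dilation) is Chae, CMP 273 (2007) Thm 2.2 (for `r v^θ`
WITH swirl, plus Ukhovskii–Yudovich global regularity) and Chae–Tsai, MRL 21 (2014) Thm 2.1–2.2 (DSS, general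
3-D vorticity: needs `ω ∈ ∩_{0<q<r} L^q` or `q < 3/(1+α)` because of vortex stretching); in the swirl-free
class the stretching is absorbed by the weight `1/r` and ONE exponent suffices (`η ∈ L²`), with no
outgoing / decay / energy condition beyond the class.

WHAT THIS IS NOT: not NS, not the crux E and not rungs C2/C3 whole — a conditional stratum (classical,
bounded `u`, `∇u`, `η ∈ L²` locally uniformly in time); the open core of E (the Chae–Shvydkoy window for
rotational, swirl-carrying or non-symmetric collapse) is untouched. [folklore]
-/

noncomputable section

-- the summit and its single problem share the name `NavierStokesRegularity` (D-0017 nested layout)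
set_option linter.dupNamespace false

open Set Function Filter Topology MeasureTheory Metric
open scoped NNReal ENNReal InnerProductSpace RealInnerProductSpace

namespace Summit.NavierStokesRegularity.NavierStokesRegularity.Theorems.PowerGaugeEulerLiouville.AxisymNoSwirl

open Literature.Analysis Literature.Analysis.FluidPDE
open Summit.NavierStokesRegularity.NavierStokesRegularity.Theorems.PowerGaugeEulerLiouville

/-! ## Irrotational classical slices vanish under the `A`-gauge -/

/-- A `C¹` divergence-free CURL-FREE slice with the `A`-gauge growth `∫_{B(0,r)} |v|² ≤ c r^{1−2ρ}`
for `r > r₀` (`ρ > −1`) vanishes a.e. — the lead's harmonic Liouville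
`ae_eq_zero_of_symm_traceFree_of_growth` fed with the classical gradient as weak gradient. [folklore] -/
theorem slice_ae_eq_zero_of_curl_eq_zero {ρ : ℝ} (hρ : -1 < ρ)
    {v : (EuclideanSpace ℝ (Fin 3)) → (EuclideanSpace ℝ (Fin 3))} (hv : ContDiff ℝ 1 v)
    (hdiv : VectorCalculus.IsDivFree v) (hcurl : ∀ x, curl v x = 0) {c r₀ : ℝ}
    (hgrowth : ∀ r : ℝ, r₀ < r → 0 < r →
      ∫⁻ x in ball (0 : (EuclideanSpace ℝ (Fin 3))) r, ‖v x‖ₑ ^ 2 ≤ ENNReal.ofReal (c * r ^ (1 - 2 * ρ))) :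
    v =ᵐ[volume] 0 := by
  have hd : Differentiable ℝ v := hv.differentiable one_ne_zero
  refine ae_eq_zero_of_symm_traceFree_of_growth (hasWeakGradient_fderiv_of_contDiff hv)
    (Eventually.of_forall fun x a b => fderiv_inner_symm_of_curl_eq_zero (hd x) (hcurl x) a b)
    (Eventually.of_forall fun x => sum_fderiv_single_apply_eq_zero_of_isDivFree hdiv x)
    (K := c) (m := 1 - 2 * ρ) (r₀ := r₀) (by linarith) hgrowth

/-! ## The DSS stratum -/

/-- **The `L²`-norm of `η` of a DSS axisymmetric swirl-free classical member vanishes.**  Under the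
class scaling `u(τ,·) = l^{1+ρ} u(l^{2+ρ}τ, l ·)` one has `∫ η(τ)² = l^{3+2ρ} ∫ η(l^{2+ρ}τ)²`
(`integral_angVortQuot_sq_smul_comp_smul`), while transport conserves `∫ η²` between the times
`l^{2+ρ}τ < τ < 0` (`integral_angVortQuot_sq_eq_of_classical`); as `l^{3+2ρ} > 1`, `∫ η(τ)² = 0`. [folklore] -/
theorem integral_angVortQuot_sq_eq_zero_of_dss {ρ : ℝ} (hρ : 0 < ρ)
    {u : ℝ → (EuclideanSpace ℝ (Fin 3)) → (EuclideanSpace ℝ (Fin 3))} {p : ℝ → (EuclideanSpace ℝ (Fin 3)) → ℝ}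
    (hns : IsClassicalNSSolutionOn (Iio 0) 0 0 u p)
    (hax : ∀ τ : ℝ, τ < 0 → IsAxisymmetric (u τ)) (hsw : ∀ τ : ℝ, τ < 0 → HasNoSwirl (u τ))
    {l : ℝ} (hl : 1 < l)
    (hdss : ∀ τ : ℝ, τ < 0 → ∀ y, u τ y = (l ^ (1 + ρ)) • u ((l ^ (2 + ρ)) * τ) (l • y))
    (hbdd : ∀ s t : ℝ, s < t → t < 0 → ∃ B : ℝ, ∀ τ ∈ Icc s t, ∀ y,
      ‖u τ y‖ ≤ B ∧ ‖fderiv ℝ (u τ) y‖ ≤ B)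
    (hL2 : ∀ s t : ℝ, s < t → t < 0 → ∃ N : ℝ, ∀ τ ∈ Icc s t,
      Integrable (fun y => angVortQuot (u τ) y ^ 2) ∧ ∫ y, angVortQuot (u τ) y ^ 2 ≤ N)
    {τ : ℝ} (hτ : τ < 0) : ∫ y, angVortQuot (u τ) y ^ 2 = 0 := by
  have hl0 : 0 < l := zero_lt_one.trans hl
  have hL : 1 < l ^ (2 + ρ) := Real.one_lt_rpow hl (by linarith)
  have hM : 1 < l ^ (3 + 2 * ρ) := Real.one_lt_rpow hl (by linarith)
  set τ' : ℝ := l ^ (2 + ρ) * τ with hτ'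
  have hτ'τ : τ' < τ := by
    have : τ' - τ = (l ^ (2 + ρ) - 1) * τ := by rw [hτ']; ring
    nlinarith
  have hτ'0 : τ' < 0 := hτ'τ.trans hτ
  -- scaling: `∫ η(τ)² = l^{3+2ρ} ∫ η(τ')²`
  have hfun : u τ = fun y => (l ^ (1 + ρ)) • u τ' (l • y) := funext fun y => hdss τ hτ y
  have hu3 : ContDiff ℝ 3 (u τ') := (hns.contDiff_velocity hτ'0).of_le (by norm_cast)
  have hscale : ∫ y, angVortQuot (u τ) y ^ 2 = (l ^ (1 + ρ)) ^ 2 * l * ∫ y, angVortQuot (u τ') y ^ 2 := by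
    rw [hfun]
    exact integral_angVortQuot_sq_smul_comp_smul (hax τ' hτ'0) hu3 _ hl0
  have hpow : (l ^ (1 + ρ)) ^ 2 * l = l ^ (3 + 2 * ρ) := by
    rw [← Real.rpow_natCast, ← Real.rpow_mul hl0.le, ← Real.rpow_add_one hl0.ne']
    norm_num; ring_nf
  -- transport: `∫ η(τ)² = ∫ η(τ')²`
  obtain ⟨B, hB⟩ := hbdd τ' τ hτ'τ hτ
  obtain ⟨N, hN⟩ := hL2 τ' τ hτ'τ hτ
  have hcons := integral_angVortQuot_sq_eq_of_classical hns hax hsw hτ'τ hτ hB hN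
  -- combine
  rw [hpow, hcons] at hscale
  have hnn : 0 ≤ ∫ y, angVortQuot (u τ') y ^ 2 := integral_nonneg fun y => sq_nonneg _
  nlinarith

/-- **Every slice of a DSS axisymmetric swirl-free classical member is irrotational**: `∫ η(τ)² = 0`
with `η(τ)` continuous forces `η(τ) ≡ 0`, hence `curl (u τ) = η · Jx ≡ 0`. [folklore] -/
theorem curl_slice_eq_zero_of_dss {ρ : ℝ} (hρ : 0 < ρ)
    {u : ℝ → (EuclideanSpace ℝ (Fin 3)) → (EuclideanSpace ℝ (Fin 3))} {p : ℝ → (EuclideanSpace ℝ (Fin 3)) → ℝ}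
    (hns : IsClassicalNSSolutionOn (Iio 0) 0 0 u p)
    (hax : ∀ τ : ℝ, τ < 0 → IsAxisymmetric (u τ)) (hsw : ∀ τ : ℝ, τ < 0 → HasNoSwirl (u τ))
    {l : ℝ} (hl : 1 < l)
    (hdss : ∀ τ : ℝ, τ < 0 → ∀ y, u τ y = (l ^ (1 + ρ)) • u ((l ^ (2 + ρ)) * τ) (l • y))
    (hbdd : ∀ s t : ℝ, s < t → t < 0 → ∃ B : ℝ, ∀ τ ∈ Icc s t, ∀ y,
      ‖u τ y‖ ≤ B ∧ ‖fderiv ℝ (u τ) y‖ ≤ B)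
    (hL2 : ∀ s t : ℝ, s < t → t < 0 → ∃ N : ℝ, ∀ τ ∈ Icc s t,
      Integrable (fun y => angVortQuot (u τ) y ^ 2) ∧ ∫ y, angVortQuot (u τ) y ^ 2 ≤ N)
    {τ : ℝ} (hτ : τ < 0) (x : (EuclideanSpace ℝ (Fin 3))) : curl (u τ) x = 0 := by
  have h0 := integral_angVortQuot_sq_eq_zero_of_dss hρ hns hax hsw hl hdss hbdd hL2 hτ
  have hu3 : ContDiff ℝ 3 (u τ) := (hns.contDiff_velocity hτ).of_le (by norm_cast)
  have hcont : Continuous (angVortQuot (u τ)) := (contDiff_angVortQuot (n := 0) hu3).continuous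
  -- integrability at `τ` from the local-uniform hypothesis on `[τ - 1, τ]`... use `[2τ, τ]`
  obtain ⟨N, hN⟩ := hL2 (2 * τ) τ (by linarith) hτ
  have hint : Integrable (fun y => angVortQuot (u τ) y ^ 2) := (hN τ ⟨by linarith, le_rfl⟩).1
  have hae : (fun y => angVortQuot (u τ) y ^ 2) =ᵐ[volume] 0 :=
    (integral_eq_zero_iff_of_nonneg (fun y => sq_nonneg _) hint).1 h0
  have hzero : (fun y => angVortQuot (u τ) y ^ 2) = 0 :=
    Continuous.ae_eq_iff_eq volume (hcont.pow 2) continuous_const |>.1 hae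
  have hΩ : ∀ y, angVortQuot (u τ) y = 0 := fun y => by
    have := congrFun hzero y
    simpa using this
  exact curl_eq_zero_of_angVortQuot_eq_zero (hax τ hτ) (hsw τ hτ) hu3 hΩ x

/-- **The axisymmetric swirl-free DSS stratum of the crux `PowerGaugeEulerLiouville`** (every `ρ > 0`;
rung C2 ∩ C3 of `Lines/rungC_window.lean`, conditional on classical regularity, bounded `u`, `∇u` and
`η = ω_θ/r ∈ L²` on compact time intervals): such a member of Seregin's power-gauged ancient Euler class
vanishes a.e. on the slab. Only the `A`-gauge, `div u = 0` and the VORTICITY transport are used (no `E`,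
no `D`, no local energy inequality). [folklore] -/
theorem ae_eq_zero_of_gauge_of_axisymNoSwirl_dss {ρ : ℝ} (hρ : 0 < ρ)
    {u : ℝ → (EuclideanSpace ℝ (Fin 3)) → (EuclideanSpace ℝ (Fin 3))} {p : ℝ → (EuclideanSpace ℝ (Fin 3)) → ℝ}
    {H : ℝ → (EuclideanSpace ℝ (Fin 3)) → (EuclideanSpace ℝ (Fin 3)) →L[ℝ] (EuclideanSpace ℝ (Fin 3))} {c : ℝ≥0}
    (hH : HasWeakSpatialGradientOn (slab (EuclideanSpace ℝ (Fin 3)) (Iio 0) isOpen_Iio) u H)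
    (hc : ∀ a : ℝ, 0 < a → ENNReal.ofReal (a ^ (2 * ρ)) * cknA a (0 : ℝ × (EuclideanSpace ℝ (Fin 3))) u +
        ENNReal.ofReal (a ^ ρ) * cknE a (0 : ℝ × (EuclideanSpace ℝ (Fin 3))) H +
        ENNReal.ofReal (a ^ (2 * ρ)) * cknD a (0 : ℝ × (EuclideanSpace ℝ (Fin 3))) p ≤ (c : ℝ≥0∞))
    (hns : IsClassicalNSSolutionOn (Iio 0) 0 0 u p)
    (hax : ∀ τ : ℝ, τ < 0 → IsAxisymmetric (u τ)) (hsw : ∀ τ : ℝ, τ < 0 → HasNoSwirl (u τ))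
    {l : ℝ} (hl : 1 < l)
    (hdss : ∀ τ : ℝ, τ < 0 → ∀ y, u τ y = (l ^ (1 + ρ)) • u ((l ^ (2 + ρ)) * τ) (l • y))
    (hbdd : ∀ s t : ℝ, s < t → t < 0 → ∃ B : ℝ, ∀ τ ∈ Icc s t, ∀ y,
      ‖u τ y‖ ≤ B ∧ ‖fderiv ℝ (u τ) y‖ ≤ B)
    (hL2 : ∀ s t : ℝ, s < t → t < 0 → ∃ N : ℝ, ∀ τ ∈ Icc s t,
      Integrable (fun y => angVortQuot (u τ) y ^ 2) ∧ ∫ y, angVortQuot (u τ) y ^ 2 ≤ N) :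
    uncurry u =ᵐ[volume.restrict (Iio (0 : ℝ) ×ˢ (univ : Set (EuclideanSpace ℝ (Fin 3))))] 0 := by
  have hA := hasScaledLocalEnergyBound_of_gauge hc
  -- every slice vanishes a.e.
  have hslice : ∀ τ : ℝ, τ < 0 → u τ =ᵐ[volume] 0 := by
    intro τ hτ
    have hu1 : ContDiff ℝ 1 (u τ) := (hns.contDiff_velocity hτ).of_le (by norm_cast)
    refine slice_ae_eq_zero_of_curl_eq_zero (ρ := ρ) (by linarith) hu1 (hns.divFree τ hτ)
      (curl_slice_eq_zero_of_dss hρ hns hax hsw hl hdss hbdd hL2 hτ) (c := (c : ℝ))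
      (r₀ := Real.sqrt (-τ)) fun r hr hr0 => ?_
    have hs : τ ∈ Ioo (-(r ^ 2)) 0 := by
      refine ⟨?_, hτ⟩
      have h4 : Real.sqrt (-τ) ^ 2 = -τ := Real.sq_sqrt (by linarith)
      nlinarith [Real.sqrt_nonneg (-τ)]
    exact hA r hr0 τ hs
  -- Tonelli on the slab (as in the irrotational stratum)
  have hmeas : AEStronglyMeasurable (uncurry u)
      (volume.restrict (Iio (0 : ℝ) ×ˢ (univ : Set (EuclideanSpace ℝ (Fin 3))))) := by
    have := hH.locallyIntegrableOn.aestronglyMeasurable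
    simpa [slab] using this
  have hint : ∫⁻ z in Iio (0 : ℝ) ×ˢ (univ : Set (EuclideanSpace ℝ (Fin 3))), ‖uncurry u z‖ₑ = 0 := by
    have hm := hmeas.aemeasurable.enorm
    rw [Measure.volume_eq_prod, ← Measure.restrict_prod_eq_prod_univ] at hm ⊢
    rw [lintegral_prod _ hm]
    have ht0 : ∀ᵐ t ∂(volume.restrict (Iio (0 : ℝ))), t < 0 := by
      rw [ae_restrict_iff' measurableSet_Iio]; exact Eventually.of_forall fun t ht => ht
    have hzero : (fun t : ℝ => ∫⁻ y, ‖uncurry u (t, y)‖ₑ) =ᵐ[volume.restrict (Iio 0)] 0 := by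
      filter_upwards [ht0] with t ht
      have : (fun y => ‖uncurry u (t, y)‖ₑ) =ᵐ[volume] fun _ => 0 := by
        filter_upwards [hslice t ht] with y hy
        simp [uncurry, hy]
      rw [lintegral_congr_ae this]
      simp
    rw [lintegral_congr_ae hzero]
    simp
  have hae := (lintegral_eq_zero_iff' hmeas.aemeasurable.enorm).1 hint
  filter_upwards [hae] with z hz
  simpa using hz

/-- **The stratum in the crux's binder shape**: the crux `PowerGaugeEulerLiouville` VERBATIM with the
extra hypotheses «classical on the open slab, axisymmetric swirl-free slices, discretely self-similar
with factor `l > 1`, bounded `u`/`∇u` and `η ∈ L²` on compact time intervals». [folklore] -/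
theorem powerGaugeEulerLiouville_axisymNoSwirl_dss :
    ∀ ρ : ℝ, 0 < ρ → ∀ (u : ℝ → EuclideanSpace ℝ (Fin 3) → EuclideanSpace ℝ (Fin 3))
      (p : ℝ → EuclideanSpace ℝ (Fin 3) → ℝ)
      (H : ℝ → EuclideanSpace ℝ (Fin 3) → EuclideanSpace ℝ (Fin 3) →L[ℝ] EuclideanSpace ℝ (Fin 3)) (c : ℝ≥0)
      (l : ℝ),
      IsSuitableWeakSolutionOn (slab (EuclideanSpace ℝ (Fin 3)) (Set.Iio 0) isOpen_Iio) 0 0 u p →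
      HasWeakSpatialGradientOn (slab (EuclideanSpace ℝ (Fin 3)) (Set.Iio 0) isOpen_Iio) u H →
      (∀ a : ℝ, 0 < a → ENNReal.ofReal (a ^ (2 * ρ)) * cknA a (0 : ℝ × EuclideanSpace ℝ (Fin 3)) u +
        ENNReal.ofReal (a ^ ρ) * cknE a (0 : ℝ × EuclideanSpace ℝ (Fin 3)) H +
        ENNReal.ofReal (a ^ (2 * ρ)) * cknD a (0 : ℝ × EuclideanSpace ℝ (Fin 3)) p ≤ (c : ℝ≥0∞)) →
      IsClassicalNSSolutionOn (Set.Iio 0) 0 0 u p →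
      (∀ τ : ℝ, τ < 0 → IsAxisymmetric (u τ) ∧ HasNoSwirl (u τ)) →
      1 < l →
      (∀ τ : ℝ, τ < 0 → ∀ y, u τ y = (l ^ (1 + ρ)) • u ((l ^ (2 + ρ)) * τ) (l • y)) →
      (∀ s t : ℝ, s < t → t < 0 → ∃ B : ℝ, ∀ τ ∈ Set.Icc s t, ∀ y,
        ‖u τ y‖ ≤ B ∧ ‖fderiv ℝ (u τ) y‖ ≤ B) →
      (∀ s t : ℝ, s < t → t < 0 → ∃ N : ℝ, ∀ τ ∈ Set.Icc s t,
        Integrable (fun y => angVortQuot (u τ) y ^ 2) ∧ ∫ y, angVortQuot (u τ) y ^ 2 ≤ N) →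
      Function.uncurry u =ᵐ[volume.restrict (Set.Iio (0 : ℝ) ×ˢ (Set.univ : Set (EuclideanSpace ℝ (Fin 3))))] 0 :=
  fun _ hρ _ _ _ _ _ _ hH hc hns hsym hl hdss hbdd hL2 =>
    ae_eq_zero_of_gauge_of_axisymNoSwirl_dss hρ hH hc hns (fun τ hτ => (hsym τ hτ).1)
      (fun τ hτ => (hsym τ hτ).2) hl hdss hbdd hL2

/-- **Exactly self-similar members are discretely self-similar of every factor**: if
`u(τ, y) = (−τ)^{−(1+ρ)/(2+ρ)} V((−τ)^{−1/(2+ρ)} y)` for `τ < 0` (the profile form of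
`Lines/rungC_window.lean :: IsSelfSimilarPair`, velocity part), then
`u(τ, y) = l^{1+ρ} u(l^{2+ρ}τ, l y)` for every `l > 0`. [folklore] -/
theorem dss_of_selfSimilar {ρ : ℝ} (hρ : 0 < ρ)
    {u : ℝ → (EuclideanSpace ℝ (Fin 3)) → (EuclideanSpace ℝ (Fin 3))} {V : (EuclideanSpace ℝ (Fin 3)) → (EuclideanSpace ℝ (Fin 3))}
    (hu : ∀ τ : ℝ, τ < 0 → ∀ y : (EuclideanSpace ℝ (Fin 3)),
      u τ y = ((-τ) ^ (-((1 + ρ) / (2 + ρ)))) • V (((-τ) ^ (-(1 / (2 + ρ)))) • y))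
    {l : ℝ} (hl : 0 < l) :
    ∀ τ : ℝ, τ < 0 → ∀ y, u τ y = (l ^ (1 + ρ)) • u ((l ^ (2 + ρ)) * τ) (l • y) := by
  intro τ hτ y
  have h2ρ : 0 < 2 + ρ := by linarith
  have hL : 0 < l ^ (2 + ρ) := Real.rpow_pos_of_pos hl _
  have hτ' : l ^ (2 + ρ) * τ < 0 := mul_neg_of_pos_of_neg hL hτ
  rw [hu τ hτ y, hu _ hτ' (l • y), smul_smul, smul_smul]
  have hneg : -(l ^ (2 + ρ) * τ) = l ^ (2 + ρ) * (-τ) := by ring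
  have hτ0 : 0 < -τ := by linarith
  -- amplitude: `l^{1+ρ} (l^{2+ρ}(−τ))^{−(1+ρ)/(2+ρ)} = (−τ)^{−(1+ρ)/(2+ρ)}`
  have hamp : l ^ (1 + ρ) * (l ^ (2 + ρ) * -τ) ^ (-((1 + ρ) / (2 + ρ))) =
      (-τ) ^ (-((1 + ρ) / (2 + ρ))) := by
    rw [Real.mul_rpow hL.le hτ0.le, ← Real.rpow_mul hl.le]
    have : (2 + ρ) * -((1 + ρ) / (2 + ρ)) = -(1 + ρ) := by field_simp
    rw [this, ← mul_assoc, ← Real.rpow_add hl]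
    simp
  -- length: `(l^{2+ρ}(−τ))^{−1/(2+ρ)} l = (−τ)^{−1/(2+ρ)}`
  have hlen : (l ^ (2 + ρ) * -τ) ^ (-(1 / (2 + ρ))) * l = (-τ) ^ (-(1 / (2 + ρ))) := by
    rw [Real.mul_rpow hL.le hτ0.le, ← Real.rpow_mul hl.le]
    have : (2 + ρ) * -(1 / (2 + ρ)) = -1 := by field_simp
    rw [this, mul_comm, ← mul_assoc, Real.rpow_neg_one, mul_inv_cancel₀ hl.ne', one_mul]
  rw [hneg, hamp, hlen]

/-- **Rung C1 ∩ C3 (conditional): no exactly self-similar axisymmetric swirl-free Euler collapse in the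
power-gauged class**, every `ρ > 0` — the crux VERBATIM restricted to members that are classical on the
open slab, axisymmetric without swirl, EXACTLY SELF-SIMILAR in the class exponents
(`u(τ,y) = (−τ)^{−(1+ρ)/(2+ρ)} V((−τ)^{−1/(2+ρ)} y)`), with bounded `u`/`∇u` and `η = ω_θ/r ∈ L²` on
compact time intervals. (By `dss_of_selfSimilar` such a member is DSS with factor `2`.) [folklore] -/
theorem powerGaugeEulerLiouville_axisymNoSwirl_selfSimilar :
    ∀ ρ : ℝ, 0 < ρ → ∀ (u : ℝ → EuclideanSpace ℝ (Fin 3) → EuclideanSpace ℝ (Fin 3))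
      (p : ℝ → EuclideanSpace ℝ (Fin 3) → ℝ)
      (H : ℝ → EuclideanSpace ℝ (Fin 3) → EuclideanSpace ℝ (Fin 3) →L[ℝ] EuclideanSpace ℝ (Fin 3)) (c : ℝ≥0)
      (V : EuclideanSpace ℝ (Fin 3) → EuclideanSpace ℝ (Fin 3)),
      IsSuitableWeakSolutionOn (slab (EuclideanSpace ℝ (Fin 3)) (Set.Iio 0) isOpen_Iio) 0 0 u p →
      HasWeakSpatialGradientOn (slab (EuclideanSpace ℝ (Fin 3)) (Set.Iio 0) isOpen_Iio) u H →
      (∀ a : ℝ, 0 < a → ENNReal.ofReal (a ^ (2 * ρ)) * cknA a (0 : ℝ × EuclideanSpace ℝ (Fin 3)) u +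
        ENNReal.ofReal (a ^ ρ) * cknE a (0 : ℝ × EuclideanSpace ℝ (Fin 3)) H +
        ENNReal.ofReal (a ^ (2 * ρ)) * cknD a (0 : ℝ × EuclideanSpace ℝ (Fin 3)) p ≤ (c : ℝ≥0∞)) →
      IsClassicalNSSolutionOn (Set.Iio 0) 0 0 u p →
      (∀ τ : ℝ, τ < 0 → IsAxisymmetric (u τ) ∧ HasNoSwirl (u τ)) →
      (∀ τ : ℝ, τ < 0 → ∀ y : EuclideanSpace ℝ (Fin 3),
        u τ y = ((-τ) ^ (-((1 + ρ) / (2 + ρ)))) • V (((-τ) ^ (-(1 / (2 + ρ)))) • y)) →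
      (∀ s t : ℝ, s < t → t < 0 → ∃ B : ℝ, ∀ τ ∈ Set.Icc s t, ∀ y,
        ‖u τ y‖ ≤ B ∧ ‖fderiv ℝ (u τ) y‖ ≤ B) →
      (∀ s t : ℝ, s < t → t < 0 → ∃ N : ℝ, ∀ τ ∈ Set.Icc s t,
        Integrable (fun y => angVortQuot (u τ) y ^ 2) ∧ ∫ y, angVortQuot (u τ) y ^ 2 ≤ N) →
      Function.uncurry u =ᵐ[volume.restrict (Set.Iio (0 : ℝ) ×ˢ (Set.univ : Set (EuclideanSpace ℝ (Fin 3))))] 0 :=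
  fun _ hρ _ _ _ _ _ _ hH hc hns hsym hss hbdd hL2 =>
    ae_eq_zero_of_gauge_of_axisymNoSwirl_dss hρ hH hc hns (fun τ hτ => (hsym τ hτ).1)
      (fun τ hτ => (hsym τ hτ).2) one_lt_two (dss_of_selfSimilar hρ hss two_pos) hbdd hL2

/-- The DSS stratum is a literal sub-case of the route decl `PowerGaugeEulerLiouville` (so it is strictly
inside the crux E and never summit-strength). [folklore] -/
theorem axisymNoSwirl_dss_of_powerGaugeEulerLiouville
    (hE : Summit.NavierStokesRegularity.NavierStokesRegularity.Theses.EulerZoomLiouville.PowerGaugeEulerLiouville) :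
    ∀ ρ : ℝ, 0 < ρ → ∀ (u : ℝ → EuclideanSpace ℝ (Fin 3) → EuclideanSpace ℝ (Fin 3))
      (p : ℝ → EuclideanSpace ℝ (Fin 3) → ℝ)
      (H : ℝ → EuclideanSpace ℝ (Fin 3) → EuclideanSpace ℝ (Fin 3) →L[ℝ] EuclideanSpace ℝ (Fin 3)) (c : ℝ≥0)
      (l : ℝ),
      IsSuitableWeakSolutionOn (slab (EuclideanSpace ℝ (Fin 3)) (Set.Iio 0) isOpen_Iio) 0 0 u p →
      HasWeakSpatialGradientOn (slab (EuclideanSpace ℝ (Fin 3)) (Set.Iio 0) isOpen_Iio) u H →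
      (∀ a : ℝ, 0 < a → ENNReal.ofReal (a ^ (2 * ρ)) * cknA a (0 : ℝ × EuclideanSpace ℝ (Fin 3)) u +
        ENNReal.ofReal (a ^ ρ) * cknE a (0 : ℝ × EuclideanSpace ℝ (Fin 3)) H +
        ENNReal.ofReal (a ^ (2 * ρ)) * cknD a (0 : ℝ × EuclideanSpace ℝ (Fin 3)) p ≤ (c : ℝ≥0∞)) →
      IsClassicalNSSolutionOn (Set.Iio 0) 0 0 u p →
      (∀ τ : ℝ, τ < 0 → IsAxisymmetric (u τ) ∧ HasNoSwirl (u τ)) →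
      1 < l →
      (∀ τ : ℝ, τ < 0 → ∀ y, u τ y = (l ^ (1 + ρ)) • u ((l ^ (2 + ρ)) * τ) (l • y)) →
      Function.uncurry u =ᵐ[volume.restrict (Set.Iio (0 : ℝ) ×ˢ (Set.univ : Set (EuclideanSpace ℝ (Fin 3))))] 0 :=
  fun ρ hρ u p H c _ hsw hH hc _ _ _ _ => hE ρ hρ u p H c hsw hH hc

end Summit.NavierStokesRegularity.NavierStokesRegularity.Theorems.PowerGaugeEulerLiouville.AxisymNoSwirl

end
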